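import Summits.QuantumFields.QCD.Theses.GaussianLinkFrames
import Summits.QuantumFields.QCD.Theorems.GaussianLinkFramesMatrixGaussian
import HarnessLib

/-!
# Route `GaussianLinkFrames` (QCD sub-problem) — the LEVER `PlaquetteGaussianFrame` (support item stmt-QuantumFields-17376), PROVED

The one-plaquette double Hubbard–Stratonovich identity: for `β ≥ 0`, `t = √(β/2)`, `c = √t` and `U_a, U_b, U_c, U_d ∈ SU(3)`,
`exp(β Re tr(U_aU_bU_c⁻¹U_d⁻¹)) = K(β) ∫dΦ dΨ dΨ′ exp(−(1+2t)‖Φ‖² − ‖Ψ‖² − ‖Ψ′‖² + 2c[Re tr(ΨᴴU_a) + Re tr(U_bΦΨ) + Re tr(U_cΦΨ′) + Re tr(Ψ′ᴴU_d)])`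
with `K(β) = (π²⁷ e^{6t+3β})⁻¹`, every link entering LINEARLY.  Proof = three Gaussian integrals over `M₃(ℂ)` with a real-linear source
(engine `GaussianLinkFramesMatrixGaussian.integral_matrix_gaussian_source`): the `Ψ′`-integral gives `π⁹ e^{t‖U_d + (U_cΦ)ᴴ‖²} =
π⁹ e^{t(3 + ‖Φ‖² + 2Re tr(U_cΦU_d))}`, the `Ψ`-integral `π⁹ e^{t(3 + ‖Φ‖² + 2Re tr(U_bΦU_a))}`, so the net `Φ`-exponent is
`−‖Φ‖² + 2t·Re tr(Φᴴ(U_aU_b + U_dU_c)ᴴ) + 6t` and the `Φ`-integral gives `π⁹ e^{6t} e^{t²‖U_aU_b + U_dU_c‖²} = π⁹ e^{6t+3β+β Re tr(U_aU_bU_cᴴU_dᴴ)}`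
(`‖U‖² = Re tr 1 = 3`, unitarity, cyclicity of the trace; the refuter's paper check rreview-0817T01-3 of 2026-08-17 is reproduced line by line).

Only this support item (a Gaussian identity) is proved; no QCD / Yang–Mills summit statement is proved here.  Cell `ym-idea-1`, LEAD seat
`ym-line-sfw-p2` g71 (free hands), `--workitem stmt-QuantumFields-17376`.
References: H. Vairinhos, P. de Forcrand, JHEP 12 (2014) 038 [VairinhosDeforcrand2014]; M. Creutz [Creutz2022].
-/

set_option autoImplicit false

noncomputable section

open MeasureTheory Complex
open scoped ComplexConjugate Matrix
open Summit.QuantumFields.QCD.Theorems.GaussianLinkFramesMatrixGaussian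

namespace Summit.QuantumFields.QCD.Theorems.GaussianLinkFramesPlaquetteGaussianFrame

/-! ## §1 Trace bookkeeping on `M₃(ℂ)` -/

variable {n : ℕ}

/-- `Re tr(Xᴴ) = Re tr X`. [folklore] -/
theorem re_trace_conjTranspose (X : Matrix (Fin n) (Fin n) ℂ) : (Xᴴ).trace.re = X.trace.re := by
  rw [Matrix.trace_conjTranspose, Complex.star_def, Complex.conj_re]

/-- `Re tr(YX) = Re tr(XᴴYᴴ)`. [folklore] -/
theorem re_trace_mul_eq_conjTranspose (X Y : Matrix (Fin n) (Fin n) ℂ) :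
    (Y * X).trace.re = (Xᴴ * Yᴴ).trace.re := by
  rw [← Matrix.conjTranspose_mul, re_trace_conjTranspose]

/-- `Re tr((X + Y)ᴴ(X + Y)) = Re tr(XᴴX) + Re tr(YᴴY) + 2 Re tr(XᴴY)`. [folklore] -/
theorem nrm_add (X Y : Matrix (Fin n) (Fin n) ℂ) :
    ((X + Y)ᴴ * (X + Y)).trace.re = (Xᴴ * X).trace.re + (Yᴴ * Y).trace.re + 2 * (Xᴴ * Y).trace.re := by
  have h : (Yᴴ * X).trace.re = (Xᴴ * Y).trace.re := by
    rw [← re_trace_conjTranspose (Xᴴ * Y), Matrix.conjTranspose_mul, Matrix.conjTranspose_conjTranspose]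
  rw [Matrix.conjTranspose_add, Matrix.add_mul, Matrix.mul_add, Matrix.mul_add, Matrix.trace_add, Matrix.trace_add,
    Matrix.trace_add, Complex.add_re, Complex.add_re, Complex.add_re, h]
  ring

/-- A real scalar pulls out of the source: `Re tr(Xᴴ((κ:ℂ)•M)) = κ·Re tr(XᴴM)`. [folklore] -/
theorem re_trace_mul_smul (X M : Matrix (Fin n) (Fin n) ℂ) (κ : ℝ) :
    (Xᴴ * ((κ : ℂ) • M)).trace.re = κ * (Xᴴ * M).trace.re := by
  rw [Matrix.mul_smul, Matrix.trace_smul, smul_eq_mul, Complex.re_ofReal_mul]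

/-- `Re tr(((κ:ℂ)•M)ᴴ((κ:ℂ)•M)) = κ²·Re tr(MᴴM)`. [folklore] -/
theorem nrm_smul (M : Matrix (Fin n) (Fin n) ℂ) (κ : ℝ) :
    ((((κ : ℂ) • M))ᴴ * ((κ : ℂ) • M)).trace.re = κ ^ 2 * (Mᴴ * M).trace.re := by
  rw [Matrix.conjTranspose_smul, Matrix.smul_mul, Matrix.mul_smul, Matrix.trace_smul, Matrix.trace_smul, smul_eq_mul, smul_eq_mul,
    Complex.star_def, Complex.conj_ofReal, ← mul_assoc, ← Complex.ofReal_mul, Complex.re_ofReal_mul]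
  ring

/-- THE ENGINE WITH A REAL COUPLING: `∫ e^{−a Re tr(XᴴX) + 2κ Re tr(XᴴM)} dX = (π/a)^{n²} e^{κ² Re tr(MᴴM)/a}`. [folklore] -/
theorem integral_matrix_gaussian_coupling {a : ℝ} (ha : 0 < a) (κ : ℝ) (M : Matrix (Fin n) (Fin n) ℂ) :
    ∫ X : Fin n → Fin n → ℂ, Real.exp (-a * ((Matrix.of X)ᴴ * Matrix.of X).trace.re + 2 * κ * ((Matrix.of X)ᴴ * M).trace.re) =
      (Real.pi / a) ^ (n * n) * Real.exp (κ ^ 2 * (Mᴴ * M).trace.re / a) := by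
  have h := integral_matrix_gaussian_source ha ((κ : ℂ) • M)
  rw [nrm_smul] at h
  simp_rw [re_trace_mul_smul] at h
  rw [← h]
  refine integral_congr_ae (Filter.Eventually.of_forall fun X => ?_)
  simp only [mul_assoc]

/-! ## §2 Unitary bookkeeping -/

/-- For `U ∈ SU(n)`: `UᴴU = 1`. [folklore] -/
theorem su_conjTranspose_mul_self (U : Matrix.specialUnitaryGroup (Fin n) ℂ) :
    (U : Matrix (Fin n) (Fin n) ℂ)ᴴ * (U : Matrix (Fin n) (Fin n) ℂ) = 1 := by
  have h := U.prop.1.1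
  rwa [Matrix.star_eq_conjTranspose] at h

/-- For `U ∈ SU(n)`: `UUᴴ = 1`. [folklore] -/
theorem su_mul_conjTranspose_self (U : Matrix.specialUnitaryGroup (Fin n) ℂ) :
    (U : Matrix (Fin n) (Fin n) ℂ) * (U : Matrix (Fin n) (Fin n) ℂ)ᴴ = 1 := by
  have h := U.prop.1.2
  rwa [Matrix.star_eq_conjTranspose] at h

/-- For `U ∈ SU(n)`: the group inverse coerces to the conjugate transpose. [folklore] -/
theorem su_coe_inv (U : Matrix.specialUnitaryGroup (Fin n) ℂ) :
    ((U⁻¹ : Matrix.specialUnitaryGroup (Fin n) ℂ) : Matrix (Fin n) (Fin n) ℂ) = (U : Matrix (Fin n) (Fin n) ℂ)ᴴ := by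
  rw [← Matrix.star_eq_inv, Matrix.specialUnitaryGroup.coe_star, Matrix.star_eq_conjTranspose]

/-- `Re tr 1 = 3` on `M₃(ℂ)`. [folklore] -/
theorem re_trace_one_three : (1 : Matrix (Fin 3) (Fin 3) ℂ).trace.re = 3 := by
  rw [Matrix.trace_one, Fintype.card_fin]; norm_num

/-- **THE COMPLETED SQUARE OF ONE LINK**: for `D, C ∈ SU(3)` and any `Φ`,
`Re tr((D + (CΦ)ᴴ)ᴴ(D + (CΦ)ᴴ)) = 3 + Re tr(ΦᴴΦ) + 2·Re tr(CΦD)`. [cite: VairinhosDeforcrand2014, §2] -/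
theorem nrm_link_source (C D : Matrix.specialUnitaryGroup (Fin 3) ℂ) (Φ : Matrix (Fin 3) (Fin 3) ℂ) :
    (((D : Matrix (Fin 3) (Fin 3) ℂ) + ((C : Matrix (Fin 3) (Fin 3) ℂ) * Φ)ᴴ)ᴴ * ((D : Matrix (Fin 3) (Fin 3) ℂ) + ((C : Matrix (Fin 3) (Fin 3) ℂ) * Φ)ᴴ)).trace.re =
      3 + (Φᴴ * Φ).trace.re + 2 * ((C : Matrix (Fin 3) (Fin 3) ℂ) * Φ * (D : Matrix (Fin 3) (Fin 3) ℂ)).trace.re := by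
  rw [nrm_add]
  have h1 : ((D : Matrix (Fin 3) (Fin 3) ℂ)ᴴ * (D : Matrix (Fin 3) (Fin 3) ℂ)).trace.re = 3 := by rw [su_conjTranspose_mul_self, re_trace_one_three]
  have h2 : ((((C : Matrix (Fin 3) (Fin 3) ℂ) * Φ)ᴴ)ᴴ * ((C : Matrix (Fin 3) (Fin 3) ℂ) * Φ)ᴴ).trace.re = (Φᴴ * Φ).trace.re := by
    rw [Matrix.conjTranspose_conjTranspose, Matrix.conjTranspose_mul, Matrix.trace_mul_comm, Matrix.mul_assoc,
      ← Matrix.mul_assoc ((C : Matrix (Fin 3) (Fin 3) ℂ)ᴴ), su_conjTranspose_mul_self, Matrix.one_mul]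
  have h3 : ((D : Matrix (Fin 3) (Fin 3) ℂ)ᴴ * ((C : Matrix (Fin 3) (Fin 3) ℂ) * Φ)ᴴ).trace.re = ((C : Matrix (Fin 3) (Fin 3) ℂ) * Φ * (D : Matrix (Fin 3) (Fin 3) ℂ)).trace.re := by
    rw [← Matrix.conjTranspose_mul, re_trace_conjTranspose]
  rw [h1, h2, h3]

/-! ## §3 The three Gaussian integrals -/

/-- **THE INNER LINK INTEGRAL** (`t ≥ 0`, `c = √t`; `C, D ∈ SU(3)`): for every real `E₀` and every `Φ`,
`∫dX exp(E₀ − Re tr(XᴴX) + 2c(Re tr(CΦX) + Re tr(XᴴD))) = e^{E₀}·π⁹·e^{t(3 + ‖Φ‖² + 2Re tr(CΦD))}`. [cite: VairinhosDeforcrand2014, §2] -/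
theorem link_integral {t : ℝ} (ht : 0 ≤ t) (C D : Matrix.specialUnitaryGroup (Fin 3) ℂ) (Φ : Matrix (Fin 3) (Fin 3) ℂ) (E₀ : ℝ) :
    ∫ X : Fin 3 → Fin 3 → ℂ, Real.exp (E₀ - ((Matrix.of X)ᴴ * Matrix.of X).trace.re +
        2 * Real.sqrt t * (((C : Matrix (Fin 3) (Fin 3) ℂ) * Φ * Matrix.of X).trace.re + ((Matrix.of X)ᴴ * (D : Matrix (Fin 3) (Fin 3) ℂ)).trace.re)) =
      Real.exp E₀ * (Real.pi ^ 9 * Real.exp (t * (3 + (Φᴴ * Φ).trace.re + 2 * ((C : Matrix (Fin 3) (Fin 3) ℂ) * Φ * (D : Matrix (Fin 3) (Fin 3) ℂ)).trace.re))) := by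
  set N : Matrix (Fin 3) (Fin 3) ℂ := (D : Matrix (Fin 3) (Fin 3) ℂ) + ((C : Matrix (Fin 3) (Fin 3) ℂ) * Φ)ᴴ with hN
  -- pointwise: the source is `2c·Re tr(Xᴴ N)`
  have hpt : ∀ X : Fin 3 → Fin 3 → ℂ,
      Real.exp (E₀ - ((Matrix.of X)ᴴ * Matrix.of X).trace.re +
        2 * Real.sqrt t * (((C : Matrix (Fin 3) (Fin 3) ℂ) * Φ * Matrix.of X).trace.re + ((Matrix.of X)ᴴ * (D : Matrix (Fin 3) (Fin 3) ℂ)).trace.re)) =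
      Real.exp E₀ * Real.exp (-1 * ((Matrix.of X)ᴴ * Matrix.of X).trace.re +
        2 * Real.sqrt t * ((Matrix.of X)ᴴ * N).trace.re) := by
    intro X
    rw [← Real.exp_add]
    congr 1
    have : ((Matrix.of X)ᴴ * N).trace.re = ((Matrix.of X)ᴴ * (D : Matrix (Fin 3) (Fin 3) ℂ)).trace.re + ((C : Matrix (Fin 3) (Fin 3) ℂ) * Φ * Matrix.of X).trace.re := by
      rw [hN, Matrix.mul_add, Matrix.trace_add, Complex.add_re, re_trace_mul_eq_conjTranspose (Matrix.of X) ((C : Matrix (Fin 3) (Fin 3) ℂ) * Φ)]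
    rw [this]; ring
  simp_rw [hpt]
  rw [integral_const_mul, integral_matrix_gaussian_coupling one_pos (Real.sqrt t) N, Real.sq_sqrt ht, hN,
    nrm_link_source C D Φ, div_one, div_one]

/-- **THE TRIPLE INTEGRAL** (`β ≥ 0`, `t = √(β/2)`, `c = √t`): the auxiliary-field integral of the item equals
`π²⁷ · e^{6t + 3β} · e^{β Re tr(U_aU_bU_cᴴU_dᴴ)}`. [cite: VairinhosDeforcrand2014, §2] -/
theorem triple_integral {β : ℝ} (hβ : 0 ≤ β) (Ua Ub Uc Ud : Matrix.specialUnitaryGroup (Fin 3) ℂ) :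
    (∫ Φf : Fin 3 → Fin 3 → ℂ, ∫ Ψf : Fin 3 → Fin 3 → ℂ, ∫ Ψ'f : Fin 3 → Fin 3 → ℂ,
      Real.exp (-((1 + 2 * Real.sqrt (β / 2)) * ((Matrix.of Φf)ᴴ * Matrix.of Φf).trace.re) -
        ((Matrix.of Ψf)ᴴ * Matrix.of Ψf).trace.re - ((Matrix.of Ψ'f)ᴴ * Matrix.of Ψ'f).trace.re +
        2 * Real.sqrt (Real.sqrt (β / 2)) *
          (((Matrix.of Ψf)ᴴ * (Ua : Matrix (Fin 3) (Fin 3) ℂ)).trace.re + ((Ub : Matrix (Fin 3) (Fin 3) ℂ) * Matrix.of Φf * Matrix.of Ψf).trace.re +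
            ((Uc : Matrix (Fin 3) (Fin 3) ℂ) * Matrix.of Φf * Matrix.of Ψ'f).trace.re + ((Matrix.of Ψ'f)ᴴ * (Ud : Matrix (Fin 3) (Fin 3) ℂ)).trace.re))) =
      Real.pi ^ 27 * Real.exp (6 * Real.sqrt (β / 2) + 3 * β) *
        Real.exp (β * ((Ua : Matrix (Fin 3) (Fin 3) ℂ) * (Ub : Matrix (Fin 3) (Fin 3) ℂ) * (Uc : Matrix (Fin 3) (Fin 3) ℂ)ᴴ * (Ud : Matrix (Fin 3) (Fin 3) ℂ)ᴴ).trace.re) := by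
  set t : ℝ := Real.sqrt (β / 2) with ht_def
  have ht : 0 ≤ t := Real.sqrt_nonneg _
  have ht2 : t ^ 2 = β / 2 := Real.sq_sqrt (by linarith)
  -- STEP 1: the `Ψ'`-integral (link D, C), for fixed Φ, Ψ
  have step1 : ∀ Φf Ψf : Fin 3 → Fin 3 → ℂ,
      (∫ Ψ'f : Fin 3 → Fin 3 → ℂ,
        Real.exp (-((1 + 2 * t) * ((Matrix.of Φf)ᴴ * Matrix.of Φf).trace.re) -
          ((Matrix.of Ψf)ᴴ * Matrix.of Ψf).trace.re - ((Matrix.of Ψ'f)ᴴ * Matrix.of Ψ'f).trace.re +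
          2 * Real.sqrt t *
            (((Matrix.of Ψf)ᴴ * (Ua : Matrix (Fin 3) (Fin 3) ℂ)).trace.re + ((Ub : Matrix (Fin 3) (Fin 3) ℂ) * Matrix.of Φf * Matrix.of Ψf).trace.re +
              ((Uc : Matrix (Fin 3) (Fin 3) ℂ) * Matrix.of Φf * Matrix.of Ψ'f).trace.re + ((Matrix.of Ψ'f)ᴴ * (Ud : Matrix (Fin 3) (Fin 3) ℂ)).trace.re))) =
      Real.exp (-((1 + 2 * t) * ((Matrix.of Φf)ᴴ * Matrix.of Φf).trace.re) - ((Matrix.of Ψf)ᴴ * Matrix.of Ψf).trace.re +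
          2 * Real.sqrt t * (((Matrix.of Ψf)ᴴ * (Ua : Matrix (Fin 3) (Fin 3) ℂ)).trace.re + ((Ub : Matrix (Fin 3) (Fin 3) ℂ) * Matrix.of Φf * Matrix.of Ψf).trace.re)) *
        (Real.pi ^ 9 * Real.exp (t * (3 + ((Matrix.of Φf)ᴴ * Matrix.of Φf).trace.re + 2 * ((Uc : Matrix (Fin 3) (Fin 3) ℂ) * Matrix.of Φf * (Ud : Matrix (Fin 3) (Fin 3) ℂ)).trace.re))) := by
    intro Φf Ψf
    rw [← link_integral ht Uc Ud (Matrix.of Φf)]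
    refine integral_congr_ae (Filter.Eventually.of_forall fun Ψ'f => ?_)
    ring_nf
  -- STEP 2: the `Ψ`-integral (link A, B), for fixed Φ
  have step2 : ∀ Φf : Fin 3 → Fin 3 → ℂ,
      (∫ Ψf : Fin 3 → Fin 3 → ℂ,
        Real.exp (-((1 + 2 * t) * ((Matrix.of Φf)ᴴ * Matrix.of Φf).trace.re) - ((Matrix.of Ψf)ᴴ * Matrix.of Ψf).trace.re +
            2 * Real.sqrt t * (((Matrix.of Ψf)ᴴ * (Ua : Matrix (Fin 3) (Fin 3) ℂ)).trace.re + ((Ub : Matrix (Fin 3) (Fin 3) ℂ) * Matrix.of Φf * Matrix.of Ψf).trace.re)) *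
          (Real.pi ^ 9 * Real.exp (t * (3 + ((Matrix.of Φf)ᴴ * Matrix.of Φf).trace.re + 2 * ((Uc : Matrix (Fin 3) (Fin 3) ℂ) * Matrix.of Φf * (Ud : Matrix (Fin 3) (Fin 3) ℂ)).trace.re)))) =
      Real.exp (-((1 + 2 * t) * ((Matrix.of Φf)ᴴ * Matrix.of Φf).trace.re)) *
        (Real.pi ^ 9 * Real.exp (t * (3 + ((Matrix.of Φf)ᴴ * Matrix.of Φf).trace.re + 2 * ((Ub : Matrix (Fin 3) (Fin 3) ℂ) * Matrix.of Φf * (Ua : Matrix (Fin 3) (Fin 3) ℂ)).trace.re))) *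
        (Real.pi ^ 9 * Real.exp (t * (3 + ((Matrix.of Φf)ᴴ * Matrix.of Φf).trace.re + 2 * ((Uc : Matrix (Fin 3) (Fin 3) ℂ) * Matrix.of Φf * (Ud : Matrix (Fin 3) (Fin 3) ℂ)).trace.re))) := by
    intro Φf
    rw [integral_mul_const, ← link_integral ht Ub Ua (Matrix.of Φf)]
    refine congrArg (· * _) (integral_congr_ae (Filter.Eventually.of_forall fun Ψf => ?_))
    ring_nf
  -- STEP 3: the `Φ`-integrand as one Gaussian with source `t·(U_aU_b + U_dU_c)ᴴ`
  set W : Matrix (Fin 3) (Fin 3) ℂ := (Ua : Matrix (Fin 3) (Fin 3) ℂ) * (Ub : Matrix (Fin 3) (Fin 3) ℂ) + (Ud : Matrix (Fin 3) (Fin 3) ℂ) * (Uc : Matrix (Fin 3) (Fin 3) ℂ) with hW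
  have step3pt : ∀ Φf : Fin 3 → Fin 3 → ℂ,
      Real.exp (-((1 + 2 * t) * ((Matrix.of Φf)ᴴ * Matrix.of Φf).trace.re)) *
        (Real.pi ^ 9 * Real.exp (t * (3 + ((Matrix.of Φf)ᴴ * Matrix.of Φf).trace.re + 2 * ((Ub : Matrix (Fin 3) (Fin 3) ℂ) * Matrix.of Φf * (Ua : Matrix (Fin 3) (Fin 3) ℂ)).trace.re))) *
        (Real.pi ^ 9 * Real.exp (t * (3 + ((Matrix.of Φf)ᴴ * Matrix.of Φf).trace.re + 2 * ((Uc : Matrix (Fin 3) (Fin 3) ℂ) * Matrix.of Φf * (Ud : Matrix (Fin 3) (Fin 3) ℂ)).trace.re))) =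
      (Real.pi ^ 18 * Real.exp (6 * t)) *
        Real.exp (-1 * ((Matrix.of Φf)ᴴ * Matrix.of Φf).trace.re + 2 * t * ((Matrix.of Φf)ᴴ * Wᴴ).trace.re) := by
    intro Φf
    have hsrc : ((Matrix.of Φf)ᴴ * Wᴴ).trace.re =
        ((Ub : Matrix (Fin 3) (Fin 3) ℂ) * Matrix.of Φf * (Ua : Matrix (Fin 3) (Fin 3) ℂ)).trace.re + ((Uc : Matrix (Fin 3) (Fin 3) ℂ) * Matrix.of Φf * (Ud : Matrix (Fin 3) (Fin 3) ℂ)).trace.re := by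
      rw [hW, Matrix.conjTranspose_add, Matrix.mul_add, Matrix.trace_add, Complex.add_re,
        ← re_trace_mul_eq_conjTranspose (Matrix.of Φf) ((Ua : Matrix (Fin 3) (Fin 3) ℂ) * (Ub : Matrix (Fin 3) (Fin 3) ℂ)),
        ← re_trace_mul_eq_conjTranspose (Matrix.of Φf) ((Ud : Matrix (Fin 3) (Fin 3) ℂ) * (Uc : Matrix (Fin 3) (Fin 3) ℂ)),
        Matrix.mul_assoc (Ua : Matrix (Fin 3) (Fin 3) ℂ) (Ub : Matrix (Fin 3) (Fin 3) ℂ), Matrix.trace_mul_comm (Ua : Matrix (Fin 3) (Fin 3) ℂ), Matrix.mul_assoc (Ud : Matrix (Fin 3) (Fin 3) ℂ) (Uc : Matrix (Fin 3) (Fin 3) ℂ), Matrix.trace_mul_comm (Ud : Matrix (Fin 3) (Fin 3) ℂ),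
        Matrix.mul_assoc, Matrix.mul_assoc]
    rw [hsrc]
    set nΦ : ℝ := ((Matrix.of Φf)ᴴ * Matrix.of Φf).trace.re
    set TBA : ℝ := ((Ub : Matrix (Fin 3) (Fin 3) ℂ) * Matrix.of Φf * (Ua : Matrix (Fin 3) (Fin 3) ℂ)).trace.re
    set TCD : ℝ := ((Uc : Matrix (Fin 3) (Fin 3) ℂ) * Matrix.of Φf * (Ud : Matrix (Fin 3) (Fin 3) ℂ)).trace.re
    calc Real.exp (-((1 + 2 * t) * nΦ)) * (Real.pi ^ 9 * Real.exp (t * (3 + nΦ + 2 * TBA))) *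
          (Real.pi ^ 9 * Real.exp (t * (3 + nΦ + 2 * TCD)))
        = Real.pi ^ 18 * Real.exp (-((1 + 2 * t) * nΦ) + t * (3 + nΦ + 2 * TBA) + t * (3 + nΦ + 2 * TCD)) := by
          rw [Real.exp_add, Real.exp_add]; ring
      _ = Real.pi ^ 18 * Real.exp (6 * t + (-1 * nΦ + 2 * t * (TBA + TCD))) := by
          congr 1; congr 1; ring
      _ = Real.pi ^ 18 * Real.exp (6 * t) * Real.exp (-1 * nΦ + 2 * t * (TBA + TCD)) := by
          rw [Real.exp_add]; ring
  have hWnrm : (Wᴴᴴ * Wᴴ).trace.re = 6 + 2 * ((Ua : Matrix (Fin 3) (Fin 3) ℂ) * (Ub : Matrix (Fin 3) (Fin 3) ℂ) * (Uc : Matrix (Fin 3) (Fin 3) ℂ)ᴴ * (Ud : Matrix (Fin 3) (Fin 3) ℂ)ᴴ).trace.re := by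
    rw [Matrix.conjTranspose_conjTranspose, Matrix.trace_mul_comm, hW, nrm_add]
    have h1 : (((Ua : Matrix (Fin 3) (Fin 3) ℂ) * (Ub : Matrix (Fin 3) (Fin 3) ℂ))ᴴ * ((Ua : Matrix (Fin 3) (Fin 3) ℂ) * (Ub : Matrix (Fin 3) (Fin 3) ℂ))).trace.re = 3 := by
      rw [Matrix.conjTranspose_mul, Matrix.mul_assoc, ← Matrix.mul_assoc ((Ua : Matrix (Fin 3) (Fin 3) ℂ)ᴴ), su_conjTranspose_mul_self, Matrix.one_mul,
        su_conjTranspose_mul_self, re_trace_one_three]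
    have h2 : (((Ud : Matrix (Fin 3) (Fin 3) ℂ) * (Uc : Matrix (Fin 3) (Fin 3) ℂ))ᴴ * ((Ud : Matrix (Fin 3) (Fin 3) ℂ) * (Uc : Matrix (Fin 3) (Fin 3) ℂ))).trace.re = 3 := by
      rw [Matrix.conjTranspose_mul, Matrix.mul_assoc, ← Matrix.mul_assoc ((Ud : Matrix (Fin 3) (Fin 3) ℂ)ᴴ), su_conjTranspose_mul_self, Matrix.one_mul,
        su_conjTranspose_mul_self, re_trace_one_three]
    have h3 : (((Ua : Matrix (Fin 3) (Fin 3) ℂ) * (Ub : Matrix (Fin 3) (Fin 3) ℂ))ᴴ * ((Ud : Matrix (Fin 3) (Fin 3) ℂ) * (Uc : Matrix (Fin 3) (Fin 3) ℂ))).trace.re = ((Ua : Matrix (Fin 3) (Fin 3) ℂ) * (Ub : Matrix (Fin 3) (Fin 3) ℂ) * (Uc : Matrix (Fin 3) (Fin 3) ℂ)ᴴ * (Ud : Matrix (Fin 3) (Fin 3) ℂ)ᴴ).trace.re := by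
      rw [← re_trace_conjTranspose, Matrix.conjTranspose_mul, Matrix.conjTranspose_conjTranspose, Matrix.conjTranspose_mul,
        Matrix.trace_mul_comm, Matrix.mul_assoc ((Ua : Matrix (Fin 3) (Fin 3) ℂ) * (Ub : Matrix (Fin 3) (Fin 3) ℂ))]
    rw [h1, h2, h3]; ring
  -- assemble
  simp_rw [step1, step2, step3pt]
  rw [integral_const_mul, integral_matrix_gaussian_coupling one_pos t Wᴴ, hWnrm, ht2, div_one, div_one]
  have e27 : Real.pi ^ 18 * Real.exp (6 * t) * (Real.pi ^ (3 * 3) * Real.exp (β / 2 * (6 + 2 * ((Ua : Matrix (Fin 3) (Fin 3) ℂ) * (Ub : Matrix (Fin 3) (Fin 3) ℂ) * (Uc : Matrix (Fin 3) (Fin 3) ℂ)ᴴ * (Ud : Matrix (Fin 3) (Fin 3) ℂ)ᴴ).trace.re))) =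
      Real.pi ^ 27 * Real.exp (6 * t + 3 * β) * Real.exp (β * ((Ua : Matrix (Fin 3) (Fin 3) ℂ) * (Ub : Matrix (Fin 3) (Fin 3) ℂ) * (Uc : Matrix (Fin 3) (Fin 3) ℂ)ᴴ * (Ud : Matrix (Fin 3) (Fin 3) ℂ)ᴴ).trace.re) := by
    rw [show β / 2 * (6 + 2 * ((Ua : Matrix (Fin 3) (Fin 3) ℂ) * (Ub : Matrix (Fin 3) (Fin 3) ℂ) * (Uc : Matrix (Fin 3) (Fin 3) ℂ)ᴴ * (Ud : Matrix (Fin 3) (Fin 3) ℂ)ᴴ).trace.re) = 3 * β + β * ((Ua : Matrix (Fin 3) (Fin 3) ℂ) * (Ub : Matrix (Fin 3) (Fin 3) ℂ) * (Uc : Matrix (Fin 3) (Fin 3) ℂ)ᴴ * (Ud : Matrix (Fin 3) (Fin 3) ℂ)ᴴ).trace.re by ring,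
      Real.exp_add, Real.exp_add]
    ring
  rw [e27]

/-! ## §4 The item -/

/-- **`PlaquetteGaussianFrame` (stmt-QuantumFields-17376), PROVED**: the one-plaquette double Hubbard–Stratonovich identity with
`K(β) = (π²⁷ e^{6t+3β})⁻¹ > 0`, `t = √(β/2)`.  Only this Gaussian identity is proved; no QCD / Yang–Mills summit statement.
[cite: VairinhosDeforcrand2014, §2] -/
theorem plaquetteGaussianFrame_proof : Summit.QuantumFields.QCD.Theses.GaussianLinkFrames.PlaquetteGaussianFrame := by
  intro β hβ
  refine ⟨(Real.pi ^ 27 * Real.exp (6 * Real.sqrt (β / 2) + 3 * β))⁻¹, by positivity, fun Ua Ub Uc Ud => ?_⟩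
  dsimp only
  rw [triple_integral hβ Ua Ub Uc Ud, Submonoid.coe_mul, Submonoid.coe_mul, Submonoid.coe_mul, su_coe_inv, su_coe_inv]
  have hpos : 0 < Real.pi ^ 27 * Real.exp (6 * Real.sqrt (β / 2) + 3 * β) := by positivity
  field_simp

end Summit.QuantumFields.QCD.Theorems.GaussianLinkFramesPlaquetteGaussianFrame

end
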